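import Literature.NumberTheory.LFunctions.KloostermanFractionsDFIfromBC
import HarnessLib

/-!
# Bettin–Chandee, *Trilinear forms with Kloosterman fractions*, Theorem 1

Topic `NumberTheory/LFunctions`.  S. Bettin, V. Chandee, *Trilinear forms with Kloosterman
fractions*, Adv. Math. 328 (2018) 1234–1262 (arXiv:1502.00769), **Theorem 1** (p. 3 of the arXiv
version), vendored AS PRINTED as a named fact (statement only, not proved here):

  "Let `ϑ ≠ 0`. Then
  `𝓑(M,N,A) ≪_ε ‖α‖ ‖β‖ ‖ν‖ (1 + |ϑ|A/(MN))^{1/2} ((AMN)^{7/20+ε}(M+N)^{1/4} + (AMN)^{3/8+ε}(AN+AM)^{1/8})`",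

where `𝓑(M,N,A) := ∑∑∑_{a, m, n, (m,n)=1} α_m β_n ν_a e(ϑ a m̄/n)`, `α_m, β_n, ν_a` arbitrary
complex coefficients supported on dyadic boxes (`[M/2,M]`, `[N/2,N]`, `[A/2,A]` in print; here the
tree's convention `(M,2M]`, `(N,2N]`, `(A,2A]` with `M, N, A ≥ 1/2` of
`DukeFriedlanderIwaniec1997_bilinearKloostermanFractions` — a change of the box convention only
rescales `M, N, A` by `2` and is absorbed in the implied constant), `m̄ m ≡ 1 (mod n)` realised as
`((m : ZMod n)⁻¹).val`, `e(t) = exp(2πit)`, and `‖·‖` the `ℓ²` norm.  (§7, p. 13: proved for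
`M ≥ N` by amplification, and for `M < N` by the reciprocity `e(ϑa m̄/n) = e(−ϑa n̄/m) e(ϑa/(mn))`
and Remark 2.)  For `A = 1` (a single numerator `a = 1`) it "improve[s] upon" (ibid. §1, (ewfc))
Duke–Friedlander–Iwaniec's Theorem 2 of Invent. Math. 128 (1997); the tree records that
implication as `DukeFriedlanderIwaniec1997_bilinearKloostermanFractions_of_BettinChandee`
(`KloostermanFractionsDFIfromBC.lean`), whose spelled-out hypothesis is exactly the `A = 1/2`,
`ν = 𝟙_{a=1}` instance of the fact below — PROVED here as
`DukeFriedlanderIwaniec1997_bilinearKloostermanFractions_of_BettinChandee2018`.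

Why here (grounding, route Parity/BatemanHorn `GaussianFractions`): the rank-2 crux
`Summit.Parity.BatemanHorn.Theses.GaussianFractions.RootFractionsBound` (stmt-Parity-12214) is a
bilinear form in Kloosterman fractions whose numerator `h(ν_r − ν_p)` is ENTANGLED with both
variables; the route's foreseen split (`ZDiagonalForm → EntangledNumerator`) names "the third
variable of a TRILINEAR form as in Bettin–Chandee's `Σ_a ν_a`" and lists "Bettin–Chandee 2018 Thm 1
(children of rank 2)" as a Literature gap.  This fact is that nearest print; it does NOT imply
`RootFractionsBound` (free numerator `ϑ a` with `a` a summation variable carrying its own arbitrary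
coefficient, versus a numerator determined by the roots).

## References

* S. Bettin, V. Chandee, *Trilinear forms with Kloosterman fractions*, Adv. Math. 328 (2018)
  1234–1262, arXiv:1502.00769, Theorem 1 and §7. [BettinChandee2018]
* W. Duke, J. Friedlander, H. Iwaniec, *Bilinear forms with Kloosterman fractions*, Invent. Math.
  128 (1997) 23–43, Theorem 2. [DukeFriedlanderIwaniec1997]
-/

noncomputable section

open Finset Real

namespace Literature.NumberTheory.LFunctions

/-- **Bettin–Chandee 2018, Theorem 1 (trilinear forms with Kloosterman fractions)**, as printed
(arXiv:1502.00769 p. 3; Adv. Math. 328 (2018), Theorem 1): "Let `ϑ ≠ 0`. Then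
`𝓑(M,N,A) ≪_ε ‖α‖‖β‖‖ν‖ (1 + |ϑ|A/(MN))^{1/2} ((AMN)^{7/20+ε}(M+N)^{1/4} + (AMN)^{3/8+ε}(AN+AM)^{1/8})`",
`𝓑(M,N,A) = ∑_{a} ∑_{m} ∑_{n, (m,n)=1} α_m β_n ν_a e(ϑ a m̄/n)` with arbitrary complex
coefficients on dyadic boxes (tree convention `(M,2M] × (N,2N] × (A,2A]`, `M, N, A ≥ 1/2`; finite
sums over `1 ≤ m ≤ ⌊2M⌋`, `1 ≤ n ≤ ⌊2N⌋`, `1 ≤ a ≤ ⌊2A⌋`; `m̄ = ((m : ZMod n)⁻¹).val`;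
`K = K_ε` depends only on `ε`).  Named fact, not proved here.  Nearest print to (and NOT a proof
of) `Summit.Parity.BatemanHorn.Theses.GaussianFractions.RootFractionsBound` (entangled numerator
there); its `A = 1/2` instance is the hypothesis of
`DukeFriedlanderIwaniec1997_bilinearKloostermanFractions_of_BettinChandee`.
[cite: BettinChandee2018, Theorem 1] -/
def BettinChandee2018_trilinearKloostermanFractions : Prop :=
  ∀ ε : ℝ, 0 < ε → ∃ K : ℝ, 0 < K ∧
    ∀ (M N A : ℝ), 1 / 2 ≤ M → 1 / 2 ≤ N → 1 / 2 ≤ A → ∀ (ϑ : ℤ), ϑ ≠ 0 →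
      ∀ (α β ν : ℕ → ℂ),
      (∀ m : ℕ, α m ≠ 0 → M < m ∧ (m : ℝ) ≤ 2 * M) →
      (∀ n : ℕ, β n ≠ 0 → N < n ∧ (n : ℝ) ≤ 2 * N) →
      (∀ a : ℕ, ν a ≠ 0 → A < a ∧ (a : ℝ) ≤ 2 * A) →
      ‖∑ a ∈ Icc 1 ⌊2 * A⌋₊, ∑ m ∈ Icc 1 ⌊2 * M⌋₊, ∑ n ∈ Icc 1 ⌊2 * N⌋₊,
          if m.Coprime n then
            α m * β n * ν a * Complex.exp (2 * Real.pi * Complex.I *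
              ((ϑ : ℂ) * (a : ℂ) * ((((m : ZMod n)⁻¹).val : ℕ) : ℂ) / (n : ℂ)))
          else 0‖ ≤
        K * Real.sqrt (∑ m ∈ Icc 1 ⌊2 * M⌋₊, ‖α m‖ ^ 2) *
          Real.sqrt (∑ n ∈ Icc 1 ⌊2 * N⌋₊, ‖β n‖ ^ 2) *
          Real.sqrt (∑ a ∈ Icc 1 ⌊2 * A⌋₊, ‖ν a‖ ^ 2) *
          (1 + |(ϑ : ℝ)| * A / (M * N)) ^ (1 / 2 : ℝ) *
          ((A * M * N) ^ (7 / 20 + ε) * (M + N) ^ (1 / 4 : ℝ) +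
            (A * M * N) ^ (3 / 8 + ε) * (A * N + A * M) ^ (1 / 8 : ℝ))

/-- **Bettin–Chandee's Theorem 1 implies Duke–Friedlander–Iwaniec's Theorem 2** (PROVED
bookkeeping): specialise `BettinChandee2018_trilinearKloostermanFractions` to a single numerator
(`A = 1/2`, `ν = 𝟙_{a = 1}`), compare `(MN/2)^{c} ≤ (MN)^{c}`, `((M+N)/2)^{1/8} ≤ (M+N)^{1/8}`,
`(1 + |ϑ|/(2MN))^{1/2} ≤ (1 + |ϑ|/(MN))^{1/2}`, and feed the result to the tree's
`DukeFriedlanderIwaniec1997_bilinearKloostermanFractions_of_BettinChandee`.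
[cite: BettinChandee2018, Theorem 1 and §1 (ewfc)] -/
theorem DukeFriedlanderIwaniec1997_bilinearKloostermanFractions_of_BettinChandee2018
    (h : BettinChandee2018_trilinearKloostermanFractions) :
    DukeFriedlanderIwaniec1997_bilinearKloostermanFractions := by
  apply DukeFriedlanderIwaniec1997_bilinearKloostermanFractions_of_BettinChandee
  intro ε hε
  obtain ⟨K, hK, hB⟩ := h ε hε
  refine ⟨K, hK, ?_⟩
  intro M N hM hN k hk α β hα hβ
  have hM0 : 0 < M := by linarith
  have hN0 : 0 < N := by linarith
  have hMN : 0 < M * N := mul_pos hM0 hN0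
  -- the single-numerator instance: `A = 1/2`, `ν = 𝟙_{a = 1}`
  have hν : ∀ a : ℕ, (fun a : ℕ => if a = 1 then (1 : ℂ) else 0) a ≠ 0 →
      (1 / 2 : ℝ) < a ∧ (a : ℝ) ≤ 2 * (1 / 2) := by
    intro a ha
    by_cases h1 : a = 1
    · subst h1; norm_num
    · simp [h1] at ha
  have hB1 := hB M N (1 / 2) hM hN le_rfl k hk α β (fun a => if a = 1 then (1 : ℂ) else 0) hα hβ hν
  have hfl : ⌊(2 : ℝ) * (1 / 2)⌋₊ = 1 := by norm_num
  simp only [hfl, Finset.Icc_self, Finset.sum_singleton, if_true, mul_one, Nat.cast_one,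
    norm_one, one_pow, Real.sqrt_one] at hB1
  -- compare the two right-hand sides
  have hnum : (1 + |(k : ℝ)| * (1 / 2) / (M * N)) ^ (1 / 2 : ℝ) ≤
      (1 + |(k : ℝ)| / (M * N)) ^ (1 / 2 : ℝ) := by
    apply Real.rpow_le_rpow (by positivity) _ (by norm_num)
    have h0 : 0 ≤ |(k : ℝ)| / (M * N) := by positivity
    have : |(k : ℝ)| * (1 / 2) / (M * N) = (|(k : ℝ)| / (M * N)) / 2 := by ring
    rw [this]; linarith
  have hP1 : (1 / 2 * M * N) ^ (7 / 20 + ε) ≤ (M * N) ^ (7 / 20 + ε) :=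
    Real.rpow_le_rpow (by positivity) (by nlinarith) (by linarith)
  have hP2 : (1 / 2 * M * N) ^ (3 / 8 + ε) ≤ (M * N) ^ (3 / 8 + ε) :=
    Real.rpow_le_rpow (by positivity) (by nlinarith) (by linarith)
  have hP3 : (1 / 2 * N + 1 / 2 * M) ^ (1 / 8 : ℝ) ≤ (M + N) ^ (1 / 8 : ℝ) :=
    Real.rpow_le_rpow (by positivity) (by linarith) (by norm_num)
  set nα := Real.sqrt (∑ m ∈ Icc 1 ⌊2 * M⌋₊, ‖α m‖ ^ 2) with hnα
  set nβ := Real.sqrt (∑ n ∈ Icc 1 ⌊2 * N⌋₊, ‖β n‖ ^ 2) with hnβ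
  have hnα0 : 0 ≤ nα := Real.sqrt_nonneg _
  have hnβ0 : 0 ≤ nβ := Real.sqrt_nonneg _
  have hR0 : 0 ≤ (M + N) ^ (1 / 4 : ℝ) := by positivity
  have hQ0 : 0 ≤ (M * N) ^ (3 / 8 + ε) := by positivity
  calc _ ≤ K * nα * nβ * (1 + |(k : ℝ)| * (1 / 2) / (M * N)) ^ (1 / 2 : ℝ) *
        ((1 / 2 * M * N) ^ (7 / 20 + ε) * (M + N) ^ (1 / 4 : ℝ) +
          (1 / 2 * M * N) ^ (3 / 8 + ε) * (1 / 2 * N + 1 / 2 * M) ^ (1 / 8 : ℝ)) := hB1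
    _ ≤ K * nα * nβ * (1 + |(k : ℝ)| / (M * N)) ^ (1 / 2 : ℝ) *
        ((M * N) ^ (7 / 20 + ε) * (M + N) ^ (1 / 4 : ℝ) +
          (M * N) ^ (3 / 8 + ε) * (M + N) ^ (1 / 8 : ℝ)) := by
      gcongr

end Literature.NumberTheory.LFunctions

end
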